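import Summits.CriticalPhenomena.PercolationContinuityZ3.Theorems.PercAnnulusCrossingIICMassNearFarPoint
import Literature.Probability.Percolation.SecondMomentMethod
import HarnessLib

/-!
# Where the IIC passes, it is fat: `ν(#(C(0) ∩ Λ_x(m)) > λ·m^d·π(m)) ≍ ν(C(0) ∩ Λ_x(m) ≠ ∅)` (lane RSW3, p1 gen 23)

builds on p205010 (kernel theorem, internal audit signed; external expert review pending) — USED only through the tree formula of
`…IICSpanningTree` (inside the second-moment bound of `…IICMassNearFarPoint`).

RSW3 lane (LANE 3 `prim-rsw3`), seat `prim-rsw3-p1` (gen 23).  Helper file (`--supports stmt-CriticalPhenomena-4575`); no definitions,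
no sorries.  Memo `run/shared/lean/prim/rsw3/P1-QM.md` §36.

With `V = #{y ∈ x + Λ(m) : 0 ↔ y}` the mass of Kesten's IIC in the far ball `Λ_x(m)`, `hit = {V > 0}`, `M = (2m+1)^d`: the first moment
`E_ν[V] ≥ c·M·π(‖x‖)` (`…IICTwoPointCU`), the hitting probability `π(m)·ν(hit) ≤ C·π(‖x‖)` (`…IICNearPoint`) and the second moment
`E_ν[V²] ≤ C·M²·π(m)·π(‖x‖)` (`…IICMassNearFarPoint`) feed the thresholded Paley–Zygmund inequality `Rsw3.sq_sub_le_real_gt_card_mul_sum`: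

* `exists_iicMeasure_sum_ball_sum_ball_real_openConn_inter_ge_criticalProbI` — Cauchy–Schwarz: **`E_ν[V²] ≥ c·M²·π(m)·π(‖x‖)`**, so with
  `…IICMassNearFarPoint` THE SECOND MOMENT IS TWO-SIDED, `E_ν[V² | hit] ≍ (M·π(m))² ≍ E_ν[V | hit]²`;

* **`exists_iicMeasure_real_fat_ball_ge_criticalProbI`** — there are `n₀ ≥ 1` and `0 < λ, c` with
  **`c·π_{p_c}(‖x‖) ≤ π_{p_c}(m) · ν(V > λ·M·π_{p_c}(m))`** for every IIC probability measure `ν`, `m ≥ 1`, `l(m+2) ≤ ‖x‖`, `4m ≤ ‖x‖`,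
  `‖x‖ ≥ n₀` — the IIC puts `≥ λ·m^d·π(m)` sites in `Λ_x(m)` with probability `≍ π(‖x‖)/π(m) ≍ ν(hit)`;
* **`exists_iicMeasure_real_fat_ball_ge_mul_hit_criticalProbI`** — hence `{V > λ·M·π(m)} ⊆ hit` and **`c·ν(hit) ≤ ν(V > λ·M·π_{p_c}(m))`**:
  GIVEN THAT THE IIC COMES WITHIN DISTANCE `m` OF A FAR SITE `x`, WITH CONDITIONAL PROBABILITY `≥ c` IT LEAVES `≥ λ·m^d·π_{p_c}(m)` SITES IN
  `Λ_x(m)` — the mass of an IIC ball of radius `m`: WHERE THE IIC PASSES, IT IS FAT (no thin tentacles at the scale of observation, in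
  probability).  With the Markov bound of `…IICMassNearFarPoint`: conditionally on `hit`, `V/(M·π(m))` is tight above and non-degenerate
  below, uniformly in `(ν, x, m)`.
All at `p_c(ℤ^d)`, `d ≥ 2`, under (A2)□(s,L) + `CU⁺_l`.  LANE-4 observable (O21): among arm-conditioned samples visiting `Λ_x(m)`, the
histogram of `V/(M·π̂(m))` (theorem: mass ≥ c away from 0 uniformly in `x, m`; census question: a scaling limit in `m/‖x‖`?).
References: H. Kesten, PTRF 73 (1986) Thm. (8); R. Lyons, Y. Peres, *Probability on Trees and Networks* (2016) §5.5 (Paley–Zygmund);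
D. Basu, A. Sapozhnikov, ECP 22 (2017) Thm. 1.1.
-/

noncomputable section

namespace Summit.CriticalPhenomena.PercolationContinuityZ3.Theorems.Crossing

open MeasureTheory Filter Topology Literature.Probability.Percolation Literature.Probability.LatticeModels
open Literature.Probability.Percolation.DCT16
open Summit.CriticalPhenomena.PercolationContinuityZ3.Theorems.SurfaceTension

variable {d : ℕ}

/-! ## The second moment of the mass in a visited far ball is two-sided -/

open Classical in
/-- **THE SECOND MOMENT OF THE IIC MASS IN A FAR BALL IS `≍ M²·π(m)·π(‖x‖)`** — lower half (`p_c(ℤ^d)`, `d ≥ 2`; (A2)□(s,L) + `CU⁺_l`):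
there are `n₀ ≥ 1` and `c > 0` with **`c·M²·π_{p_c}(m)·π_{p_c}(‖x‖) ≤ Σ_{y, y' ∈ Λ_x(m)} ν(0 ↔ y, 0 ↔ y')`** for every IIC probability
measure `ν`, `m ≥ 1`, `l(m+2) ≤ ‖x‖`, `‖x‖ ≥ n₀` (`M = (2m+1)^d`): Cauchy–Schwarz `(Σ_y ν(0 ↔ y))² ≤ ν(hit)·Σ_{y,y'} ν(0 ↔ y, 0 ↔ y')`
with `Σ_y ν(0 ↔ y) ≥ c·M·π(‖x‖)` (`…IICTwoPointCU`) and `π(m)·ν(hit) ≤ C·π(‖x‖)` (`…IICNearPoint`).  With `…IICMassNearFarPoint`: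
`E_ν[V²] ≍ M²·π(m)·π(‖x‖)` and `E_ν[V² | hit] ≍ (M·π(m))² ≍ E_ν[V | hit]²`. [cite: Kesten1986, Thm. (8)] -/
theorem exists_iicMeasure_sum_ball_sum_ball_real_openConn_inter_ge_criticalProbI (hd : 2 ≤ d) {s L : ℕ} (hs : 2 ≤ s)
    (hsL : s ≤ L) {ϰ : ℝ} (hϰ : 0 < ϰ) (hA2 : SetToSetQuasiMultAspectAt d (criticalProbI d) s L ϰ) {l : ℕ} (hl : 2 ≤ l)
    {cU : ℝ} (hcU : 0 < cU)
    (hCU : ∀ a : ℕ, 1 ≤ a → ∀ E : Set (BondConfig (Site d)), IsUpperSet E → MeasurableSet E →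
      cU * (bondPercolation (zdGraph d) (criticalProbI d)).real E ≤ (bondPercolation (zdGraph d) (criticalProbI d)).real (E ∩
        {ω : BondConfig (Site d) | ∀ t ∈ innerBoundary (zdGraph d) (box d a), ∀ s ∈ innerBoundary (zdGraph d) (box d (l * a)),
          ∀ t' ∈ innerBoundary (zdGraph d) (box d a), ∀ s' ∈ innerBoundary (zdGraph d) (box d (l * a)),
          ω ∈ openConnIn (↑((box d (l * a) \ box d a) ∪ innerBoundary (zdGraph d) (box d a)) : Set (Site d)) t s →
          ω ∈ openConnIn (↑((box d (l * a) \ box d a) ∪ innerBoundary (zdGraph d) (box d a)) : Set (Site d)) t' s' →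
          ω ∈ openConnIn (↑((box d (l * a) \ box d a) ∪ innerBoundary (zdGraph d) (box d a)) : Set (Site d)) s s'})) :
    ∃ (n₀ : ℕ) (c : ℝ), 1 ≤ n₀ ∧ 0 < c ∧ ∀ (ν : Measure (BondConfig (Site d))) [IsProbabilityMeasure ν],
      (∀ (F : Finset (Sym2 (Site d))) (E : Set (BondConfig (Site d))), MeasurableSet E → DeterminedBy E ↑F →
        Tendsto (fun n : ℕ => (bondPercolation (zdGraph d) (criticalProbI d)).real (E ∩ siteToBoundary d n) /
          oneArmProb d (criticalProbI d) n) atTop (𝓝 (ν.real E))) →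
      ∀ (m : ℕ) (x : Site d), 1 ≤ m → l * (m + 2) ≤ Site.supNorm x → n₀ ≤ Site.supNorm x →
        c * (((2 * m + 1 : ℕ) : ℝ) ^ d) ^ 2 * oneArmProb d (criticalProbI d) m * oneArmProb d (criticalProbI d) (Site.supNorm x) ≤
          ∑ y ∈ (box d m).image (· + x), ∑ y' ∈ (box d m).image (· + x),
            ν.real ((openConn (0 : Site d) y : Set (BondConfig (Site d))) ∩ openConn (0 : Site d) y') := by
  have hd1 : 1 ≤ d := le_trans (by norm_num) hd
  have hp : 0 < ((criticalProbI d : unitInterval) : ℝ) := by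
    rw [coe_criticalProbI]; exact criticalProb_zd_pos d hd1
  have hπ : ∀ m : ℕ, 0 < oneArmProb d (criticalProbI d) m := fun m => oneArmProb_pos hd1 _ hp m
  obtain ⟨cN, CN, hcN, hCN, hN⟩ := exists_iicMeasure_real_exists_openConn_ball_two_sided_criticalProbI hd hs hsL hϰ hA2 hl hcU hCU
  obtain ⟨n₀, cS, CS, hn₀, hcS, hCS, hS⟩ := exists_iicMeasure_sum_ball_real_openConn_two_sided_criticalProbI hd hs hsL hϰ hA2 hl hcU hCU
  refine ⟨2 * n₀, cS ^ 2 / CN, by omega, by positivity, fun ν _ hν m x hm hlx hn₀x => ?_⟩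
  have hπm := hπ m
  have hπn := hπ (Site.supNorm x)
  have h2m : 2 * m ≤ Site.supNorm x := le_trans (by nlinarith) hlx
  obtain ⟨-, hN2⟩ := hN ν hν m x hm hlx
  obtain ⟨hS1, -⟩ := hS ν hν m x h2m hn₀x
  set T := (box d m).image (· + x) with hTdef
  set M : ℝ := ((2 * m + 1 : ℕ) : ℝ) ^ d with hM
  set πm := oneArmProb d (criticalProbI d) m with hπmdef
  set πn := oneArmProb d (criticalProbI d) (Site.supNorm x) with hπndef
  clear_value πm πn
  have hU : (⋃ y ∈ T, (openConn (0 : Site d) y : Set (BondConfig (Site d)))) =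
      {ω | ∃ q ∈ T, ω ∈ (openConn (0 : Site d) q : Set (BondConfig (Site d)))} := by
    ext ω; simp only [Set.mem_iUnion, Set.mem_setOf_eq, exists_prop]
  have hCS' := sq_sum_measureReal_le_measureReal_biUnion_mul_sum ν T (fun y => (openConn (0 : Site d) y : Set (BondConfig (Site d))))
    (fun y _ => measurableSet_openConn_holds 0 y)
  rw [hU] at hCS'
  set H := ν.real {ω | ∃ q ∈ T, ω ∈ (openConn (0 : Site d) q : Set (BondConfig (Site d)))} with hHdef
  set S1 := ∑ y ∈ T, ν.real (openConn (0 : Site d) y) with hS1def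
  set S2 := ∑ y ∈ T, ∑ y' ∈ T, ν.real ((openConn (0 : Site d) y : Set (BondConfig (Site d))) ∩ openConn (0 : Site d) y')
    with hS2def
  have hCS2 : S1 ^ 2 ≤ H * S2 := hCS'
  have hH0 : 0 ≤ H := measureReal_nonneg
  have hS20 : 0 ≤ S2 := Finset.sum_nonneg fun _ _ => Finset.sum_nonneg fun _ _ => measureReal_nonneg
  have hM0 : 0 < M := by positivity
  clear_value H S1 S2
  have h0 : 0 ≤ cS * M * πn := by positivity
  have h1 : (cS * M * πn) ^ 2 ≤ H * S2 := (pow_le_pow_left₀ h0 hS1 2).trans hCS2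
  rw [div_mul_eq_mul_div, div_mul_eq_mul_div, div_mul_eq_mul_div, div_le_iff₀ hCN]
  have h2 : πm * (cS * M * πn) ^ 2 ≤ CN * πn * S2 := by
    calc πm * (cS * M * πn) ^ 2 ≤ πm * (H * S2) := mul_le_mul_of_nonneg_left h1 hπm.le
      _ = (πm * H) * S2 := by ring
      _ ≤ (CN * πn) * S2 := mul_le_mul_of_nonneg_right hN2 hS20
      _ = CN * πn * S2 := by ring
  have h3 : (cS ^ 2 * M ^ 2 * πm * πn) * πn ≤ (S2 * CN) * πn := by
    calc (cS ^ 2 * M ^ 2 * πm * πn) * πn = πm * (cS * M * πn) ^ 2 := by ring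
      _ ≤ CN * πn * S2 := h2
      _ = (S2 * CN) * πn := by ring
  exact le_of_mul_le_mul_right h3 hπn

/-! ## Paley–Zygmund: where the IIC passes, it is fat -/

open Classical in
/-- **WHERE THE IIC PASSES, IT IS FAT** (`p_c(ℤ^d)`, `d ≥ 2`; (A2)□ at aspect `(s,L)`, `2 ≤ s ≤ L`, `ϰ > 0`; `CU⁺_l(c_U)`, `l ≥ 2`, `c_U > 0`):
there are `n₀ ≥ 1` and `0 < λ, c` such that for every IIC probability measure `ν`, every `m ≥ 1` and every site `x` with `l(m+2) ≤ ‖x‖_∞`,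
`4m ≤ ‖x‖_∞`, `n₀ ≤ ‖x‖_∞`:
**`c·π_{p_c}(‖x‖) ≤ π_{p_c}(m) · ν(#{y ∈ Λ_x(m) : 0 ↔ y} > λ·(2m+1)^d·π_{p_c}(m))`** — the IIC puts `≥ λ·m^d·π(m)` sites in the far
ball `Λ_x(m)` with probability `≍ π(‖x‖)/π(m) ≍ ν(dist(x, C(0)) ≤ m)` (second-moment method: first moment `≥ c·M·π(‖x‖)`, `…IICTwoPointCU`;
`ν(hit) ≤ C·π(‖x‖)/π(m)`, `…IICNearPoint`; second moment `≤ C·M²·π(m)·π(‖x‖)`, §2; the thresholded Paley–Zygmund inequality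
`Rsw3.sq_sub_le_real_gt_card_mul_sum`). [cite: Kesten1986, Thm. (8)] [cite: LyonsPeres2016, §5.5 (Paley–Zygmund inequality)] -/
theorem exists_iicMeasure_real_fat_ball_ge_criticalProbI (hd : 2 ≤ d) {s L : ℕ} (hs : 2 ≤ s) (hsL : s ≤ L)
    {ϰ : ℝ} (hϰ : 0 < ϰ) (hA2 : SetToSetQuasiMultAspectAt d (criticalProbI d) s L ϰ) {l : ℕ} (hl : 2 ≤ l) {cU : ℝ} (hcU : 0 < cU)
    (hCU : ∀ a : ℕ, 1 ≤ a → ∀ E : Set (BondConfig (Site d)), IsUpperSet E → MeasurableSet E →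
      cU * (bondPercolation (zdGraph d) (criticalProbI d)).real E ≤ (bondPercolation (zdGraph d) (criticalProbI d)).real (E ∩
        {ω : BondConfig (Site d) | ∀ t ∈ innerBoundary (zdGraph d) (box d a), ∀ s ∈ innerBoundary (zdGraph d) (box d (l * a)),
          ∀ t' ∈ innerBoundary (zdGraph d) (box d a), ∀ s' ∈ innerBoundary (zdGraph d) (box d (l * a)),
          ω ∈ openConnIn (↑((box d (l * a) \ box d a) ∪ innerBoundary (zdGraph d) (box d a)) : Set (Site d)) t s →
          ω ∈ openConnIn (↑((box d (l * a) \ box d a) ∪ innerBoundary (zdGraph d) (box d a)) : Set (Site d)) t' s' →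
          ω ∈ openConnIn (↑((box d (l * a) \ box d a) ∪ innerBoundary (zdGraph d) (box d a)) : Set (Site d)) s s'})) :
    ∃ (n₀ : ℕ) (lam c : ℝ), 1 ≤ n₀ ∧ 0 < lam ∧ 0 < c ∧ ∀ (ν : Measure (BondConfig (Site d))) [IsProbabilityMeasure ν],
      (∀ (F : Finset (Sym2 (Site d))) (E : Set (BondConfig (Site d))), MeasurableSet E → DeterminedBy E ↑F →
        Tendsto (fun n : ℕ => (bondPercolation (zdGraph d) (criticalProbI d)).real (E ∩ siteToBoundary d n) /
          oneArmProb d (criticalProbI d) n) atTop (𝓝 (ν.real E))) →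
      ∀ (m : ℕ) (x : Site d), 1 ≤ m → l * (m + 2) ≤ Site.supNorm x → 4 * m ≤ Site.supNorm x → n₀ ≤ Site.supNorm x →
        c * oneArmProb d (criticalProbI d) (Site.supNorm x) ≤ oneArmProb d (criticalProbI d) m *
          ν.real {ω | lam * ((2 * m + 1 : ℕ) : ℝ) ^ d * oneArmProb d (criticalProbI d) m <
            ((((box d m).image (· + x)).filter fun y => ω ∈ (openConn (0 : Site d) y : Set (BondConfig (Site d)))).card : ℝ)} := by
  have hd1 : 1 ≤ d := le_trans (by norm_num) hd
  have hp : 0 < ((criticalProbI d : unitInterval) : ℝ) := by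
    rw [coe_criticalProbI]; exact criticalProb_zd_pos d hd1
  have hπ : ∀ m : ℕ, 0 < oneArmProb d (criticalProbI d) m := fun m => oneArmProb_pos hd1 _ hp m
  obtain ⟨cN, CN, hcN, hCN, hN⟩ := exists_iicMeasure_real_exists_openConn_ball_two_sided_criticalProbI hd hs hsL hϰ hA2 hl hcU hCU
  obtain ⟨n₀, cS, CS, hn₀, hcS, hCS, hS⟩ := exists_iicMeasure_sum_ball_real_openConn_two_sided_criticalProbI hd hs hsL hϰ hA2 hl hcU hCU
  obtain ⟨n₁, K, hn₁, hK, h2⟩ := exists_iicMeasure_sum_ball_sum_ball_real_openConn_inter_le_criticalProbI hd hs hsL hϰ hA2 hl hcU hCU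
  refine ⟨2 * n₀ + n₁, cS / (2 * CN), cS ^ 2 / (4 * K), by omega, by positivity, by positivity,
    fun ν _ hν m x hm hlx h4m hn₀x => ?_⟩
  have hπm := hπ m
  have hπn := hπ (Site.supNorm x)
  have h2m : 2 * m ≤ Site.supNorm x := by omega
  obtain ⟨-, hN2⟩ := hN ν hν m x hm hlx
  obtain ⟨hS1, -⟩ := hS ν hν m x h2m (by omega)
  have hSS := h2 ν hν m x hm h4m (by omega)
  -- name the real quantities
  set T := (box d m).image (· + x) with hTdef
  set M : ℝ := ((2 * m + 1 : ℕ) : ℝ) ^ d with hM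
  set πm := oneArmProb d (criticalProbI d) m with hπmdef
  set πn := oneArmProb d (criticalProbI d) (Site.supNorm x) with hπndef
  clear_value πm πn
  have hU : (⋃ y ∈ T, (openConn (0 : Site d) y : Set (BondConfig (Site d)))) =
      {ω | ∃ q ∈ T, ω ∈ (openConn (0 : Site d) q : Set (BondConfig (Site d)))} := by
    ext ω; simp only [Set.mem_iUnion, Set.mem_setOf_eq, exists_prop]
  set H := ν.real {ω | ∃ q ∈ T, ω ∈ (openConn (0 : Site d) q : Set (BondConfig (Site d)))} with hHdef
  set S1 := ∑ y ∈ T, ν.real (openConn (0 : Site d) y) with hS1def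
  set S2 := ∑ y ∈ T, ∑ y' ∈ T, ν.real ((openConn (0 : Site d) y : Set (BondConfig (Site d))) ∩ openConn (0 : Site d) y')
    with hS2def
  set t : ℝ := cS / (2 * CN) * M * πm with ht
  set F := ν.real {ω | t < ((T.filter fun y => ω ∈ (openConn (0 : Site d) y : Set (BondConfig (Site d)))).card : ℝ)} with hFdef
  have hM0 : 0 < M := by positivity
  have ht0 : 0 ≤ t := by positivity
  have hH0 : 0 ≤ H := measureReal_nonneg
  have hF0 : 0 ≤ F := measureReal_nonneg
  -- `t H ≤ (cS/2) M π(n) ≤ S1/2`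
  have htU : t * H ≤ cS / 2 * M * πn := by
    calc t * H = cS / (2 * CN) * M * (πm * H) := by rw [ht]; ring
      _ ≤ cS / (2 * CN) * M * (CN * πn) := mul_le_mul_of_nonneg_left hN2 (by positivity)
      _ = cS / 2 * M * πn := by field_simp
  have hmid : 0 ≤ cS / 2 * M * πn := by positivity
  have hle : t * ν.real (⋃ y ∈ T, (openConn (0 : Site d) y : Set (BondConfig (Site d)))) ≤ S1 := by
    rw [hU]; linarith
  have hPZ := Rsw3.sq_sub_le_real_gt_card_mul_sum ν T (fun y => (openConn (0 : Site d) y : Set (BondConfig (Site d))))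
    (fun y _ => measurableSet_openConn_holds 0 y) ht0 hle
  rw [hU] at hPZ
  have hPZ' : (S1 - t * H) ^ 2 ≤ F * S2 := hPZ
  have hgap : cS / 2 * M * πn ≤ S1 - t * H := by linarith
  have hsq : (cS / 2 * M * πn) ^ 2 ≤ F * (K * M ^ 2 * πm * πn) :=
    (pow_le_pow_left₀ hmid hgap 2).trans (hPZ'.trans (mul_le_mul_of_nonneg_left hSS hF0))
  -- divide by `K M² π(n)`
  have hpos : 0 < K * M ^ 2 * πn := by positivity
  have key : cS ^ 2 / (4 * K) * πn * (K * M ^ 2 * πn) ≤ πm * F * (K * M ^ 2 * πn) := by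
    calc cS ^ 2 / (4 * K) * πn * (K * M ^ 2 * πn) = (cS / 2 * M * πn) ^ 2 := by field_simp; ring
      _ ≤ F * (K * M ^ 2 * πm * πn) := hsq
      _ = πm * F * (K * M ^ 2 * πn) := by ring
  exact le_of_mul_le_mul_right key hpos

open Classical in
/-- **GIVEN THAT THE IIC VISITS A FAR BALL, IT IS FAT THERE WITH CONDITIONAL PROBABILITY `≥ c`** (`p_c(ℤ^d)`, `d ≥ 2`; (A2)□(s,L) +
`CU⁺_l`): there are `n₀ ≥ 1` and `0 < λ, c` such that for every IIC probability measure `ν`, every `m ≥ 1` and every `x` with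
`l(m+2) ≤ ‖x‖_∞`, `4m ≤ ‖x‖_∞`, `n₀ ≤ ‖x‖_∞`, the event `F = {#{y ∈ Λ_x(m) : 0 ↔ y} > λ·(2m+1)^d·π_{p_c}(m)}` satisfies `F ⊆ hit` and
**`c · ν(hit) ≤ ν(F)`**, `hit = {∃ q ∈ Λ_x(m), 0 ↔ q}` (`…_fat_ball_ge…` and `π(m)·ν(hit) ≤ C·π(‖x‖)`, `…IICNearPoint`).
[cite: Kesten1986, Thm. (8)] [cite: LyonsPeres2016, §5.5 (Paley–Zygmund inequality)] -/
theorem exists_iicMeasure_real_fat_ball_ge_mul_hit_criticalProbI (hd : 2 ≤ d) {s L : ℕ} (hs : 2 ≤ s) (hsL : s ≤ L)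
    {ϰ : ℝ} (hϰ : 0 < ϰ) (hA2 : SetToSetQuasiMultAspectAt d (criticalProbI d) s L ϰ) {l : ℕ} (hl : 2 ≤ l) {cU : ℝ} (hcU : 0 < cU)
    (hCU : ∀ a : ℕ, 1 ≤ a → ∀ E : Set (BondConfig (Site d)), IsUpperSet E → MeasurableSet E →
      cU * (bondPercolation (zdGraph d) (criticalProbI d)).real E ≤ (bondPercolation (zdGraph d) (criticalProbI d)).real (E ∩
        {ω : BondConfig (Site d) | ∀ t ∈ innerBoundary (zdGraph d) (box d a), ∀ s ∈ innerBoundary (zdGraph d) (box d (l * a)),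
          ∀ t' ∈ innerBoundary (zdGraph d) (box d a), ∀ s' ∈ innerBoundary (zdGraph d) (box d (l * a)),
          ω ∈ openConnIn (↑((box d (l * a) \ box d a) ∪ innerBoundary (zdGraph d) (box d a)) : Set (Site d)) t s →
          ω ∈ openConnIn (↑((box d (l * a) \ box d a) ∪ innerBoundary (zdGraph d) (box d a)) : Set (Site d)) t' s' →
          ω ∈ openConnIn (↑((box d (l * a) \ box d a) ∪ innerBoundary (zdGraph d) (box d a)) : Set (Site d)) s s'})) :
    ∃ (n₀ : ℕ) (lam c : ℝ), 1 ≤ n₀ ∧ 0 < lam ∧ 0 < c ∧ ∀ (ν : Measure (BondConfig (Site d))) [IsProbabilityMeasure ν],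
      (∀ (F : Finset (Sym2 (Site d))) (E : Set (BondConfig (Site d))), MeasurableSet E → DeterminedBy E ↑F →
        Tendsto (fun n : ℕ => (bondPercolation (zdGraph d) (criticalProbI d)).real (E ∩ siteToBoundary d n) /
          oneArmProb d (criticalProbI d) n) atTop (𝓝 (ν.real E))) →
      ∀ (m : ℕ) (x : Site d), 1 ≤ m → l * (m + 2) ≤ Site.supNorm x → 4 * m ≤ Site.supNorm x → n₀ ≤ Site.supNorm x →
        {ω | lam * ((2 * m + 1 : ℕ) : ℝ) ^ d * oneArmProb d (criticalProbI d) m <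
            ((((box d m).image (· + x)).filter fun y => ω ∈ (openConn (0 : Site d) y : Set (BondConfig (Site d)))).card : ℝ)} ⊆
          {ω | ∃ q ∈ (box d m).image (· + x), ω ∈ (openConn (0 : Site d) q : Set (BondConfig (Site d)))} ∧
        c * ν.real {ω | ∃ q ∈ (box d m).image (· + x), ω ∈ (openConn (0 : Site d) q : Set (BondConfig (Site d)))} ≤
          ν.real {ω | lam * ((2 * m + 1 : ℕ) : ℝ) ^ d * oneArmProb d (criticalProbI d) m <
            ((((box d m).image (· + x)).filter fun y => ω ∈ (openConn (0 : Site d) y : Set (BondConfig (Site d)))).card : ℝ)} := by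
  have hd1 : 1 ≤ d := le_trans (by norm_num) hd
  have hp : 0 < ((criticalProbI d : unitInterval) : ℝ) := by
    rw [coe_criticalProbI]; exact criticalProb_zd_pos d hd1
  have hπ : ∀ m : ℕ, 0 < oneArmProb d (criticalProbI d) m := fun m => oneArmProb_pos hd1 _ hp m
  obtain ⟨cN, CN, hcN, hCN, hN⟩ := exists_iicMeasure_real_exists_openConn_ball_two_sided_criticalProbI hd hs hsL hϰ hA2 hl hcU hCU
  obtain ⟨n₀, lam, c, hn₀, hlam, hc, hF⟩ := exists_iicMeasure_real_fat_ball_ge_criticalProbI hd hs hsL hϰ hA2 hl hcU hCU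
  refine ⟨n₀, lam, c / CN, hn₀, hlam, by positivity, fun ν _ hν m x hm hlx h4m hn₀x => ⟨?_, ?_⟩⟩
  · intro ω hω
    rw [Set.mem_setOf_eq] at hω
    have hpos : 0 < (((box d m).image (· + x)).filter fun y => ω ∈ (openConn (0 : Site d) y : Set (BondConfig (Site d)))).card := by
      have hπm := hπ m
      have h0 : (0 : ℝ) ≤ lam * ((2 * m + 1 : ℕ) : ℝ) ^ d * oneArmProb d (criticalProbI d) m := by positivity
      exact_mod_cast h0.trans_lt hω
    obtain ⟨q, hq⟩ := Finset.card_pos.1 hpos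
    exact ⟨q, (Finset.mem_filter.1 hq).1, (Finset.mem_filter.1 hq).2⟩
  · obtain ⟨-, hN2⟩ := hN ν hν m x hm hlx
    have h := hF ν hν m x hm hlx h4m hn₀x
    have hπm := hπ m
    set πm := oneArmProb d (criticalProbI d) m with hπmdef
    set πn := oneArmProb d (criticalProbI d) (Site.supNorm x) with hπndef
    clear_value πm πn
    set H := ν.real {ω | ∃ q ∈ (box d m).image (· + x), ω ∈ (openConn (0 : Site d) q : Set (BondConfig (Site d)))} with hHdef
    set F := ν.real {ω | lam * ((2 * m + 1 : ℕ) : ℝ) ^ d * πm <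
      ((((box d m).image (· + x)).filter fun y => ω ∈ (openConn (0 : Site d) y : Set (BondConfig (Site d)))).card : ℝ)} with hFdef
    -- `hN2 : πm H ≤ CN πn`, `h : c πn ≤ πm F`; goal `c/CN · H ≤ F`
    rw [div_mul_eq_mul_div, div_le_iff₀ hCN]
    have key : πm * (c * H) ≤ πm * (F * CN) := by
      calc πm * (c * H) = c * (πm * H) := by ring
        _ ≤ c * (CN * πn) := mul_le_mul_of_nonneg_left hN2 hc.le
        _ = CN * (c * πn) := by ring
        _ ≤ CN * (πm * F) := mul_le_mul_of_nonneg_left h hCN.le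
        _ = πm * (F * CN) := by ring
    exact le_of_mul_le_mul_left key hπm

end Summit.CriticalPhenomena.PercolationContinuityZ3.Theorems.Crossing

end
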